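import Literature.AlgebraicTopology.SingularHomology.HurewiczProofs
import Literature.AlgebraicTopology.SingularHomology.CupProduct
import Literature.AlgebraicTopology.FundamentalGroup.CircleAndTorus
import Mathlib.Topology.Covering.AddCircle
import Mathlib.Topology.Homotopy.Lifting
import HarnessLib

/-!
# The integral generator of `H¹(S¹)`: an explicit `ℤ`-valued singular `1`-cocycle on `ℝ/ℤ`

A. Hatcher, *Algebraic Topology* (2002), Thm. 1.7 / Prop. 1.30 (lifting paths in the covering
`ℝ → S¹`, `π₁(S¹) ≅ ℤ` by the end point of the lift) and §3.1 p. 198 (`H¹(X; G) = Hom(H₁(X), G)`;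
the generator of `H¹(S¹; ℤ) ≅ ℤ` is "evaluation of the winding number"). We write down, once and
for all rings, a singular `1`-cocycle `ϑ` on `S¹ = ℝ/ℤ` (`UnitAddCircle`) with INTEGER values whose
value on the fundamental loop is `1`:

  `ϑ(c) = ⌊ĉ(1)⌋ - ⌊ĉ(0)⌋ ∈ ℤ`,

where `ĉ : [0, 1] → ℝ` is the lift of the edge path `t ↦ c(1 - t, t)` of the singular `1`-simplex
`c : Δ¹ → ℝ/ℤ` through the covering map `ℝ → ℝ/ℤ` starting at the representative of `c(v₀)` in
`[0, 1)` (`pathLift`; Mathlib's `IsCoveringMap.liftPath` for `AddCircle.isCoveringMap_coe`).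

* `windingCochain_boundary` — **`ϑ` is a cocycle**: for a singular `2`-simplex `ρ` of `ℝ/ℤ`,
  `ϑ(d₀ρ) - ϑ(d₁ρ) + ϑ(d₂ρ) = 0`. Proof (Hatcher Prop. 1.30 / the tree's `HurewiczProofs`: the
  edges `[e₀,e₁]·[e₁,e₂] ≃ [e₀,e₂]` rel end points in the simply connected `Δ²`): the lifts of
  `ρ∘[e₀,e₁]` and `ρ∘[e₀,e₂]` start at the same point; the end point `a` of the first and the start
  of the lift of `ρ∘[e₁,e₂]` both lie over `ρ(e₁)`, so differ by an integer `k`; shifting the latter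
  by `k` and concatenating (`IsCoveringMap.liftPath_trans`) gives a lift of `ρ∘([e₀,e₁]·[e₁,e₂])`
  from the common start, which ends where the lift of `ρ∘[e₀,e₂]` ends
  (`liftPath_apply_one_eq_of_homotopicRel`); the floors then telescope.
* `circleCocycle R`, `circleClass R : H¹(ℝ/ℤ; R)` — the cocycle `c ↦ (ϑ(c) : R)` and its class,
  for every commutative ring `R` (so the classes for `ℤ`, `ℚ`, `ℝ`, `ℂ` are represented by ONE
  integer-valued cochain: `circleCochain_apply`);
* `circleLoopSimplex` — the fundamental loop `t ↦ t mod 1` as a singular `1`-simplex, a loop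
  (`circleLoopSimplex_face`), with **`ϑ(loop) = 1`** (`windingCochain_circleLoopSimplex`,
  `circleCochain_circleLoopSimplex`): the lift is `t ↦ t`;
* `windingCochain_map_const` — `ϑ` vanishes on constant simplices (lifts of constant paths are
  constant), so `circleCocycle` pulls back to `0` along constant maps
  (`cocyclesMap_const_circleCocycle`, `map_const_circleClass`).

With the loop transfer (`LoopTransfer.lean`: `loopEval`, `cupProduct_map_fst_map_snd_injective`)
these give the injectivity of `b ↦ pr₁*b ⌣ pr₂*θ`, `θ = circleClass R`, for every space `X` and
ring `R`, the first half of the Künneth formula for `X × S¹` (Hatcher Thm. 3.15). Everything here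
is proved; no named facts.

## References

* A. Hatcher, *Algebraic Topology*, CUP 2002, Thm. 1.7, Prop. 1.30, §3.1 p. 198, Example 3.16.
  [HatcherAT2002]
-/

noncomputable section

open Set CategoryTheory

universe u v

namespace Literature.AlgebraicTopology.SingularHomology

open SingularSimplex StdSimplex HurewiczProof
open Literature.AlgebraicTopology.FundamentalGroup (addCircleLoop addCircleLoop_apply)

/-! ### Canonical representatives and lifts through `ℝ → ℝ/ℤ` -/

section Lift

/-- `0 < 1`, the period of `UnitAddCircle = ℝ/ℤ`, as a `Fact` (for `AddCircle.equivIco`). [folklore] -/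
instance instFactZeroLtOneReal : Fact ((0 : ℝ) < 1) := ⟨one_pos⟩

/-- The representative in `[0, 1)` of a point of `ℝ/ℤ`. [cite: HatcherAT2002, Thm. 1.7] -/
def circleRep (x : UnitAddCircle) : ℝ := (AddCircle.equivIco (1 : ℝ) 0 x : ℝ)

/-- `circleRep x` lies in `[0, 1)`. [cite: HatcherAT2002, Thm. 1.7] -/
theorem circleRep_mem (x : UnitAddCircle) : circleRep x ∈ Ico (0 : ℝ) 1 := by
  have h := (AddCircle.equivIco (1 : ℝ) 0 x).2
  change (AddCircle.equivIco (1 : ℝ) 0 x : ℝ) ∈ Ico (0 : ℝ) 1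
  exact ⟨h.1, by have h2 := h.2; linarith⟩

/-- `circleRep x` represents `x`. [cite: HatcherAT2002, Thm. 1.7] -/
@[simp]
theorem coe_circleRep (x : UnitAddCircle) : ((circleRep x : ℝ) : UnitAddCircle) = x := by
  obtain ⟨y, hy, rfl⟩ : ∃ y : ℝ, y ∈ Ico (0 : ℝ) (0 + 1) ∧ (y : UnitAddCircle) = x := by
    refine ⟨(AddCircle.equivIco (1 : ℝ) 0 x : ℝ), (AddCircle.equivIco (1 : ℝ) 0 x).2, ?_⟩
    exact (AddCircle.equivIco (1 : ℝ) 0).symm_apply_apply x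
  rw [circleRep, AddCircle.equivIco_coe_eq hy]

/-- The representative of (the class of) a real number in `[0, 1)` is itself. [cite: HatcherAT2002, Thm. 1.7] -/
theorem circleRep_coe_of_mem {y : ℝ} (hy : y ∈ Ico (0 : ℝ) 1) : circleRep (y : UnitAddCircle) = y := by
  rw [circleRep, AddCircle.equivIco_coe_eq (by simpa using hy)]

/-- `circleRep 0 = 0`. [cite: HatcherAT2002, Thm. 1.7] -/
@[simp]
theorem circleRep_zero : circleRep 0 = 0 := by
  have h := circleRep_coe_of_mem (y := 0) ⟨le_rfl, one_pos⟩
  rwa [QuotientAddGroup.mk_zero] at h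

/-- `⌊circleRep x⌋ = 0`. [cite: HatcherAT2002, Thm. 1.7] -/
@[simp]
theorem floor_circleRep (x : UnitAddCircle) : ⌊circleRep x⌋ = 0 :=
  Int.floor_eq_zero_iff.2 (circleRep_mem x)

/-- Two real numbers with the same class in `ℝ/ℤ` differ by an integer. [cite: HatcherAT2002, Thm. 1.7] -/
theorem exists_int_eq_sub_of_coe_eq {a b : ℝ} (h : (a : UnitAddCircle) = (b : UnitAddCircle)) :
    ∃ k : ℤ, a = b + k := by
  have h' : ((a - b : ℝ) : UnitAddCircle) = 0 := by rw [AddCircle.coe_sub, h, sub_self]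
  obtain ⟨n, hn⟩ := (AddCircle.coe_eq_zero_iff (1 : ℝ)).1 h'
  refine ⟨n, ?_⟩
  rw [zsmul_eq_mul, mul_one] at hn
  linarith

/-- Adding an integer does not change the class in `ℝ/ℤ`. [cite: HatcherAT2002, Thm. 1.7] -/
theorem coe_add_intCast (b : ℝ) (k : ℤ) : ((b + k : ℝ) : UnitAddCircle) = (b : UnitAddCircle) := by
  rw [AddCircle.coe_add]
  have hk : ((k : ℝ) : UnitAddCircle) = 0 := (AddCircle.coe_eq_zero_iff (1 : ℝ)).2 ⟨k, by simp⟩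
  rw [hk, add_zero]

/-- The covering map `ℝ → ℝ/ℤ`. [cite: HatcherAT2002, Thm. 1.7] -/
theorem isCoveringMap_coe_unitAddCircle : IsCoveringMap ((↑) : ℝ → UnitAddCircle) :=
  AddCircle.isCoveringMap_coe 1

variable {x y z : UnitAddCircle}

/-- **The lift of a path of `ℝ/ℤ`** through `ℝ → ℝ/ℤ`, starting at the representative of its source
in `[0, 1)` (Hatcher 2002, Prop. 1.30: unique path lifting). [cite: HatcherAT2002, Prop. 1.30] -/
def pathLift (γ : Path x y) : C(unitInterval, ℝ) :=
  isCoveringMap_coe_unitAddCircle.liftPath (γ : C(unitInterval, UnitAddCircle)) (circleRep x)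
    (by rw [coe_circleRep]; exact γ.source)

/-- `pathLift γ` lifts `γ`. [cite: HatcherAT2002, Prop. 1.30] -/
@[simp]
theorem coe_pathLift (γ : Path x y) (t : unitInterval) : ((pathLift γ t : ℝ) : UnitAddCircle) = γ t :=
  congrFun (isCoveringMap_coe_unitAddCircle.liftPath_lifts (γ : C(unitInterval, UnitAddCircle)) (circleRep x)
    (by rw [coe_circleRep]; exact γ.source)) t

/-- `pathLift γ 0 = circleRep x`. [cite: HatcherAT2002, Prop. 1.30] -/
@[simp]
theorem pathLift_zero (γ : Path x y) : pathLift γ 0 = circleRep x :=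
  isCoveringMap_coe_unitAddCircle.liftPath_zero _ _ _

/-- Congruence of lifts (the proof arguments are irrelevant). [folklore] -/
theorem liftPath_congr {γ₁ γ₂ : C(unitInterval, UnitAddCircle)} {e₁ e₂ : ℝ} (hγ : γ₁ = γ₂) (he : e₁ = e₂)
    (h₁ : γ₁ 0 = (e₁ : UnitAddCircle)) (h₂ : γ₂ 0 = (e₂ : UnitAddCircle)) :
    isCoveringMap_coe_unitAddCircle.liftPath γ₁ e₁ h₁ =
      isCoveringMap_coe_unitAddCircle.liftPath γ₂ e₂ h₂ := by
  subst hγ; subst he; rfl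

/-- Paths which agree pointwise have the same lift (their sources then agree). [cite: HatcherAT2002, Prop. 1.30] -/
theorem pathLift_congr {x' y' : UnitAddCircle} {γ : Path x y} {γ' : Path x' y'} (h : ∀ t, γ t = γ' t) :
    pathLift γ = pathLift γ' := by
  have hx : x = x' := by rw [← γ.source, ← γ'.source]; exact h 0
  exact liftPath_congr (ContinuousMap.ext h) (by rw [hx]) _ _

/-- **Uniqueness of lifts**: a continuous real function lifting `γ` and starting at `circleRep x` is
`pathLift γ` (Hatcher 2002, Prop. 1.30). [cite: HatcherAT2002, Prop. 1.30] -/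
theorem eq_pathLift {γ : Path x y} (G : C(unitInterval, ℝ)) (hG : ∀ t, ((G t : ℝ) : UnitAddCircle) = γ t)
    (h0 : G 0 = circleRep x) : G = pathLift γ :=
  (isCoveringMap_coe_unitAddCircle.eq_liftPath_iff' _).2 ⟨funext hG, h0⟩

/-- A lift shifted by an integer is the lift from the shifted start (uniqueness of lifts).
[cite: HatcherAT2002, Prop. 1.30] -/
theorem liftPath_eq_add_intCast (γ : Path x y) (k : ℤ) (h : (γ : C(unitInterval, UnitAddCircle)) 0 =
      ((circleRep x + k : ℝ) : UnitAddCircle)) (t : unitInterval) :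
    isCoveringMap_coe_unitAddCircle.liftPath (γ : C(unitInterval, UnitAddCircle)) (circleRep x + k) h t =
      pathLift γ t + k := by
  have e : (⟨fun t => pathLift γ t + k, (pathLift γ).continuous.add continuous_const⟩ : C(unitInterval, ℝ)) =
      isCoveringMap_coe_unitAddCircle.liftPath (γ : C(unitInterval, UnitAddCircle)) (circleRep x + k) h :=
    (isCoveringMap_coe_unitAddCircle.eq_liftPath_iff' _).2
      ⟨funext fun t => by simp only [ContinuousMap.coe_mk, Function.comp_apply, coe_add_intCast, coe_pathLift], by simp⟩
  exact (congrFun (congrArg DFunLike.coe e) t).symm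

/-- The lift of a constant path is constant. [cite: HatcherAT2002, Prop. 1.30] -/
theorem pathLift_refl (x : UnitAddCircle) (t : unitInterval) : pathLift (Path.refl x) t = circleRep x := by
  have e : (ContinuousMap.const unitInterval (circleRep x) : C(unitInterval, ℝ)) = pathLift (Path.refl x) :=
    eq_pathLift _ (fun t => by simp) rfl
  exact (congrFun (congrArg DFunLike.coe e) t).symm

end Lift

/-! ### The winding cochain -/

section Cochain

/-- **The integral winding cochain** of `ℝ/ℤ`: `ϑ(c) = ⌊ĉ(1)⌋ - ⌊ĉ(0)⌋` for the lift `ĉ` of the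
edge path of the singular `1`-simplex `c` starting in `[0, 1)` (Hatcher 2002, Thm. 1.7: the end
point of the lifted loop is the winding number; §3.1 p. 198). [cite: HatcherAT2002, §3.1 p. 198] -/
def windingCochain (c : SingularSimplex UnitAddCircle 1) : ℤ :=
  ⌊pathLift c.toPath 1⌋ - ⌊pathLift c.toPath 0⌋

/-- `ϑ(c) = ⌊ĉ(1)⌋` (the lift starts in `[0, 1)`). [cite: HatcherAT2002, §3.1 p. 198] -/
theorem windingCochain_eq (c : SingularSimplex UnitAddCircle 1) :
    windingCochain c = ⌊pathLift c.toPath 1⌋ := by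
  rw [windingCochain, pathLift_zero, floor_circleRep, sub_zero]

/-- **The cocycle identity** `ϑ(d₀ρ) - ϑ(d₁ρ) + ϑ(d₂ρ) = 0` for every singular `2`-simplex `ρ` of
`ℝ/ℤ` (Hatcher 2002, Prop. 1.30 with `[e₀,e₁]·[e₁,e₂] ≃ [e₀,e₂]` in `Δ²`; module docstring).
[cite: HatcherAT2002, Prop. 1.30] -/
theorem windingCochain_boundary (ρ : SingularSimplex UnitAddCircle 2) :
    windingCochain (ρ.face 0) - windingCochain (ρ.face 1) + windingCochain (ρ.face 2) = 0 := by
  -- the three edges of `ρ`, as paths between the images of the vertices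
  have hρ := (toContinuousMap ρ).continuous
  set P₀ := stdSimplex.vertex (S := ℝ) (0 : Fin 3) with hP₀_def
  set P₁ := stdSimplex.vertex (S := ℝ) (1 : Fin 3) with hP₁_def
  set P₂ := stdSimplex.vertex (S := ℝ) (2 : Fin 3) with hP₂_def
  set γ₁ : Path (toContinuousMap ρ P₀) (toContinuousMap ρ P₁) := edge01.map hρ with hγ₁
  set γ₂ : Path (toContinuousMap ρ P₁) (toContinuousMap ρ P₂) := edge12.map hρ with hγ₂
  set γ₃ : Path (toContinuousMap ρ P₀) (toContinuousMap ρ P₂) := edge02.map hρ with hγ₃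
  have e2 : pathLift (ρ.face 2).toPath = pathLift γ₁ := pathLift_congr (toPath_face_two_apply ρ)
  have e0 : pathLift (ρ.face 0).toPath = pathLift γ₂ := pathLift_congr (toPath_face_zero_apply ρ)
  have e1 : pathLift (ρ.face 1).toPath = pathLift γ₃ := pathLift_congr (toPath_face_one_apply ρ)
  simp only [windingCochain, e0, e1, e2, pathLift_zero, floor_circleRep, sub_zero]
  -- the end point `a` of the lift of `γ₁` lies over `ρ(e₁)`, as does the start of the lift of `γ₂`
  obtain ⟨k, hk⟩ : ∃ k : ℤ, pathLift γ₁ 1 = circleRep (toContinuousMap ρ P₁) + k := by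
    apply exists_int_eq_sub_of_coe_eq
    rw [coe_pathLift, coe_circleRep]
    exact γ₁.target
  -- the lift of `γ₂` from `a = pathLift γ₁ 1` is the canonical lift shifted by `k`
  have hstart : (γ₂ : C(unitInterval, UnitAddCircle)) 0 =
      ((circleRep (toContinuousMap ρ P₁) + k : ℝ) : UnitAddCircle) := by
    rw [coe_add_intCast, coe_circleRep]
    exact γ₂.source
  have hshift := liftPath_eq_add_intCast γ₂ k hstart 1
  -- concatenation: the lift of `γ₁ · γ₂` from `circleRep ρ(e₀)` ends at `pathLift γ₂ 1 + k`
  have hP₀ : toContinuousMap ρ P₀ = ((circleRep (toContinuousMap ρ P₀) : ℝ) : UnitAddCircle) :=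
    (coe_circleRep _).symm
  have htrans := isCoveringMap_coe_unitAddCircle.liftPath_trans hP₀ γ₁ γ₂
  have h0 : ((γ₁.trans γ₂ : Path _ _) : C(unitInterval, UnitAddCircle)) 0 =
      ((circleRep (toContinuousMap ρ P₀) : ℝ) : UnitAddCircle) := by simp
  have h0' : (γ₃ : C(unitInterval, UnitAddCircle)) 0 =
      ((circleRep (toContinuousMap ρ P₀) : ℝ) : UnitAddCircle) := by simp
  have hend : isCoveringMap_coe_unitAddCircle.liftPath
      ((γ₁.trans γ₂ : Path _ _) : C(unitInterval, UnitAddCircle))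
      (circleRep (toContinuousMap ρ P₀)) h0 1 = pathLift γ₂ 1 + k := by
    have hpt : ∀ {a b : ℝ} (p : Path a b), (p : C(unitInterval, ℝ)) 1 = b := fun p => p.target
    rw [htrans, hpt]
    have ha : isCoveringMap_coe_unitAddCircle.liftPath (γ₁ : C(unitInterval, UnitAddCircle))
        (circleRep (toContinuousMap ρ P₀)) (γ₁.source.trans hP₀) 1 =
          circleRep (toContinuousMap ρ P₁) + k := hk
    rw [← hshift]
    exact congrFun (congrArg DFunLike.coe (liftPath_congr rfl ha _ hstart)) 1
  -- path independence in the simply connected `Δ²`: the same end point as the lift of `γ₃`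
  have hhom : ((γ₁.trans γ₂ : Path _ _) : C(unitInterval, UnitAddCircle)).HomotopicRel
      (γ₃ : C(unitInterval, UnitAddCircle)) {0, 1} := by
    have h := edge01_trans_edge12.map (toContinuousMap ρ)
    rw [Path.map_trans] at h
    exact ⟨h.some⟩
  have hindep := isCoveringMap_coe_unitAddCircle.liftPath_apply_one_eq_of_homotopicRel hhom
    (circleRep (toContinuousMap ρ P₀)) h0 h0'
  have h3 : pathLift γ₃ 1 = pathLift γ₂ 1 + k := by
    rw [← hend, hindep]
    rfl
  rw [h3, hk, Int.floor_add_intCast, Int.floor_add_intCast, floor_circleRep]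
  ring

/-- **`ϑ` vanishes on constant simplices**: the lift of a constant path is constant.
[cite: HatcherAT2002, Prop. 1.30] -/
theorem windingCochain_map_const {X : Type} [TopologicalSpace X] (c : SingularSimplex X 1)
    (y : UnitAddCircle) : windingCochain (c.map (ContinuousMap.const X y)) = 0 := by
  have h : pathLift (c.map (ContinuousMap.const X y)).toPath = pathLift (Path.refl y) :=
    pathLift_congr fun t => rfl
  rw [windingCochain, h, pathLift_refl, pathLift_refl, sub_self]

end Cochain

/-! ### The fundamental loop -/

section Loop

/-- **The fundamental loop** `t ↦ t mod 1` of `ℝ/ℤ`, as a singular `1`-simplex (Hatcher 2002,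
Thm. 1.7, the loop `ω`). [cite: HatcherAT2002, Thm. 1.7] -/
def circleLoopSimplex : SingularSimplex UnitAddCircle 1 :=
  ofPath (addCircleLoop (1 : ℝ) 0)

/-- The fundamental loop is a loop: its two vertices coincide. [cite: HatcherAT2002, Thm. 1.7] -/
theorem circleLoopSimplex_face : circleLoopSimplex.face 0 = circleLoopSimplex.face 1 := by
  rw [circleLoopSimplex, ofPath_face_zero, ofPath_face_one]

/-- The lift of the fundamental loop is `t ↦ t`. [cite: HatcherAT2002, Thm. 1.7] -/
theorem pathLift_addCircleLoop (t : unitInterval) :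
    pathLift (addCircleLoop (1 : ℝ) 0) t = t := by
  have e : (⟨fun t : unitInterval => (t : ℝ), continuous_subtype_val⟩ : C(unitInterval, ℝ)) =
      pathLift (addCircleLoop (1 : ℝ) 0) :=
    eq_pathLift _ (fun t => by
      rw [addCircleLoop_apply, mul_one, zero_add]
      rfl) (by simp)
  exact (congrFun (congrArg DFunLike.coe e) t).symm

/-- **`ϑ(loop) = 1`**: the winding cochain is normalised on the fundamental loop (Hatcher 2002,
Thm. 1.7: the lift of `ω` from `0` ends at `1`). [cite: HatcherAT2002, Thm. 1.7] -/
theorem windingCochain_circleLoopSimplex : windingCochain circleLoopSimplex = 1 := by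
  have h : pathLift circleLoopSimplex.toPath =
      pathLift (addCircleLoop (1 : ℝ) 0) :=
    pathLift_congr (toPath_ofPath_apply _)
  rw [windingCochain, h, pathLift_addCircleLoop, pathLift_addCircleLoop]
  simp

end Loop

/-! ### The cocycle and its class, for every coefficient ring -/

section Class

variable (R : Type v) [CommRing R]

/-- The winding cochain with values in `R`: `c ↦ (ϑ(c) : R)`. [cite: HatcherAT2002, §3.1 p. 198] -/
def circleCochain : SingularSimplex UnitAddCircle 1 → R := fun c => (windingCochain c : R)

/-- Values of `circleCochain`. [cite: HatcherAT2002, §3.1 p. 198] -/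
@[simp]
theorem circleCochain_apply (c : SingularSimplex UnitAddCircle 1) :
    circleCochain R c = (windingCochain c : R) := rfl

/-- `circleCochain R` is a cocycle. [cite: HatcherAT2002, §3.1 p. 198] -/
theorem d_circleCochain : (singularCochainComplex R R UnitAddCircle).d 1 (1 + 1) (circleCochain R) = 0 := by
  refine singularCochainComplex.ext fun ρ => ?_
  rw [singularCochainComplex.d_apply, Fin.sum_univ_three]
  change _ = (0 : R)
  have h := congrArg (fun z : ℤ => (z : R)) (windingCochain_boundary ρ)
  simp only [Int.cast_add, Int.cast_sub, Int.cast_zero] at h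
  simp only [circleCochain_apply, Fin.val_zero, pow_zero, Fin.val_one, pow_one, Fin.val_two, neg_one_sq,
    smul_eq_mul, one_mul]
  rw [← h]
  ring

/-- **The integral generating cocycle of `H¹(ℝ/ℤ; R)`**. [cite: HatcherAT2002, §3.1 p. 198] -/
def circleCocycle : singularCochainComplex.cocycles R R UnitAddCircle 1 :=
  singularCochainComplex.cocyclesMk (circleCochain R) (d_circleCochain R)

/-- The underlying cochain of `circleCocycle R`. [cite: HatcherAT2002, §3.1 p. 198] -/
@[simp]
theorem iCocycles_circleCocycle :
    singularCochainComplex.iCocycles R R UnitAddCircle 1 (circleCocycle R) = circleCochain R :=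
  singularCochainComplex.iCocycles_mk _ (d_circleCochain R)

/-- **The generator `θ = [ϑ] ∈ H¹(ℝ/ℤ; R)`** (Hatcher 2002, §3.1 p. 198; Example 3.16 for the
torus). [cite: HatcherAT2002, §3.1 p. 198] -/
def circleClass : singularCohomology R R UnitAddCircle 1 :=
  singularCohomology.π R R UnitAddCircle 1 (circleCocycle R)

/-- `θ(loop) = 1` on the representing cocycle. [cite: HatcherAT2002, Thm. 1.7] -/
theorem circleCochain_circleLoopSimplex : circleCochain R circleLoopSimplex = 1 := by
  rw [circleCochain_apply, windingCochain_circleLoopSimplex, Int.cast_one]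

/-- **`θ` pulls back to `0` along constant maps**, already on cocycles. [cite: HatcherAT2002, §3.1 p. 198] -/
theorem cocyclesMap_const_circleCocycle {X : Type} [TopologicalSpace X] (y : UnitAddCircle) :
    singularCochainComplex.cocyclesMap R R (ContinuousMap.const X y) 1 (circleCocycle R) = 0 := by
  refine singularCochainComplex.cocycles_ext ?_
  rw [singularCochainComplex.iCocycles_cocyclesMap, iCocycles_circleCocycle, map_zero]
  funext c
  rw [singularCochainComplex.map_apply, circleCochain_apply, windingCochain_map_const, Int.cast_zero]
  rfl

/-- `const^* θ = 0` in `H¹(X; R)`. [cite: HatcherAT2002, §3.1 p. 198] -/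
theorem map_const_circleClass {X : Type} [TopologicalSpace X] (y : UnitAddCircle) :
    singularCohomology.map R R (ContinuousMap.const X y) 1 (circleClass R) = 0 := by
  rw [circleClass, singularCohomology.map_π, cocyclesMap_const_circleCocycle, map_zero]

end Class

end Literature.AlgebraicTopology.SingularHomology
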